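import Literature.MathematicalPhysics.KineticTheory.CellChainEnergyFlow
import Literature.MathematicalPhysics.KineticTheory.CellChainLangevin
import Summits.AtomisticToContinuum.FouriersLaw.Theses.MatthiessenLadder
import HarnessLib

/-!
# Stub S `stub_prefixEnergyScale` of crux `PrefixSteadyStates` (line `registered`, skeleton r12):
# pathwise energy bookkeeping at scale `K⁴` along the driven flow of a cell chain

`--supports stmt-AtomisticToContinuum-12778`. PORT of `LangevinChainEnergyScale.lean` (pinned chain,
flow `chainFlow`) to the cell chains `cellChain ω₂ lam β γ c` on the model-free pathwise layer
`drivenFlow ((cellChain …).langevinDrift N) x (0, η)` (`ConfinedForcedFlow.lean`), the pathwise solution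
of the Langevin equation driven by a continuous momentum-noise path `η` whose law under the Brownian
pair is the Langevin kernel (`SiteChainLangevinKernel.lean`). The work is done in three Literature
layers landed for this stub:

* `CellChainEnergyScale.lean` — CEHR Lemma 5.10 at scale `K` for the cell chains (force and momentum
  bounds, the linear energy bound `∑|∂_qH| + 2γ∑|p| ≤ (A/K)H + BK³` with the pinned constants
  `A = pinnedChainScaleA γ N`, `B = pinnedChainScaleB ω₂ lam β γ N`);
* `SiteChainPathwiseEnergy.lean` — for any site chain: the energy identity with the dissipation along
  a solution of `z = x + (0, η) + ∫Y(z)` and Grönwall for the smooth part `y = z - (0, η)`;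
* `CellChainEnergyFlow.lean` — the ceiling `H(y(t)) ≤ c₁K⁴` (`c₁ = pinnedChainScaleC`) and the
  two-sided bookkeeping `|H(z(t)) - H(x) + γ∫₀ᵗ∑ᵢwᵢȳᵢ²| ≤ C₂M(TK³ + K² + M)`,
  `C₂ = Ac₁ + B + N(c₁ + 1/2)`, specialised to `drivenFlow` (`cellChain_drivenFlow_energyScale`).

Here the registered signature is assembled with `A := pinnedChainScaleA γ N`, `C₁ := c₁`, `C₂` as above.

## References

* N. Cuneo, J.-P. Eckmann, M. Hairer, L. Rey-Bellet, *Non-equilibrium steady states for networks of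
  oscillators*, Electron. J. Probab. **23** (2018) no. 55 (arXiv:1712.09413), §3 eq. (3.3), §5 p. 11,
  Lemma 5.10.
-/

noncomputable section

namespace Summit.AtomisticToContinuum.FouriersLaw.Theorems.PrefixSteadyStates.LineRegistered

open MeasureTheory Filter Topology
open scoped NNReal ENNReal
open Literature.MathematicalPhysics.KineticTheory.HeatConduction

/-- **Stub S (r12) — pathwise energy bookkeeping at scale `K⁴` for the driven flow of a cell chain** (PORT of
`LangevinChainEnergyScale.lean` to `drivenFlow ((cellChain …).langevinDrift N) x (0, η)`, the pathwise
solution of the Langevin equation driven by a continuous momentum-noise path `η`; `ω₂ > 0`, `lam, β, γ ≥ 0`,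
any indicator, any `N`). There are constants `A ≥ 1`, `C₁, C₂ ≥ 0` such that for `K ≥ 1`, `H(x) ≤ 2K⁴`,
`‖η‖ ≤ M` on `[0, T]` and `A M T ≤ K`: along `[0, T]` the smooth part `y = z - (0, η)` stays below the ceiling
`H(y(t)) ≤ C₁K⁴` (Grönwall at scale `K`), and the energy identity with the dissipation
`H(z(t)) = H(x) - γ∫₀ᵗ ∑ᵢ wᵢ ȳᵢ² + (cross terms)` holds up to `|cross terms| ≤ C₂ M (T K³ + K² + M)`
(`wᵢ = [i=0] + [i=N-1]`); here `A = pinnedChainScaleA γ N`, `C₁ = pinnedChainScaleC ω₂ lam β γ N`,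
`C₂ = A C₁ + pinnedChainScaleB ω₂ lam β γ N + N (C₁ + 1/2)` (`cellChain_drivenFlow_energyScale`).
[cite: CuneoEckmannHairerReyBellet2018, §5 p. 11 and Lemma 5.10] -/
theorem stub_prefixEnergyScale :
    ∀ ω₂ lam β γ : ℝ, 0 < ω₂ → 0 ≤ lam → 0 ≤ β → 0 ≤ γ → ∀ (c : ℕ → Bool) (N : ℕ),
      ∃ A C₁ C₂ : ℝ, 1 ≤ A ∧ 0 ≤ C₁ ∧ 0 ≤ C₂ ∧
        ∀ K : ℝ, 1 ≤ K → ∀ x : PhaseSpace N, (cellChain ω₂ lam β γ c).hamiltonian N x ≤ 2 * K ^ 4 →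
          ∀ (η : ℝ → Fin N → ℝ) (T M : ℝ), Continuous η → (∀ t ∈ Set.Icc (0 : ℝ) T, ‖η t‖ ≤ M) →
            A * M * T ≤ K →
            ∀ t ∈ Set.Icc (0 : ℝ) T,
              (cellChain ω₂ lam β γ c).hamiltonian N
                  (Literature.MathematicalPhysics.KineticTheory.drivenFlow
                      ((cellChain ω₂ lam β γ c).langevinDrift N) x (fun s => ((0 : Fin N → ℝ), η s)) t -
                    ((0 : Fin N → ℝ), η t)) ≤ C₁ * K ^ 4 ∧
              |(cellChain ω₂ lam β γ c).hamiltonian N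
                    (Literature.MathematicalPhysics.KineticTheory.drivenFlow
                      ((cellChain ω₂ lam β γ c).langevinDrift N) x (fun s => ((0 : Fin N → ℝ), η s)) t) -
                  (cellChain ω₂ lam β γ c).hamiltonian N x +
                  γ * ∫ s in (0 : ℝ)..t, ∑ i, OscillatorChain.bathWeight N i *
                    (Literature.MathematicalPhysics.KineticTheory.drivenFlow
                        ((cellChain ω₂ lam β γ c).langevinDrift N) x (fun s => ((0 : Fin N → ℝ), η s)) s -
                      ((0 : Fin N → ℝ), η s)).2 i ^ 2| ≤
                C₂ * M * (T * K ^ 3 + K ^ 2 + M) := by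
  intro ω₂ lam β γ hω hl hβ hγ c N
  refine ⟨pinnedChainScaleA γ N, pinnedChainScaleC ω₂ lam β γ N,
    pinnedChainScaleA γ N * pinnedChainScaleC ω₂ lam β γ N + pinnedChainScaleB ω₂ lam β γ N +
      N * (pinnedChainScaleC ω₂ lam β γ N + 1 / 2),
    one_le_pinnedChainScaleA hγ N, pinnedChainScaleC_nonneg hω.le hl hβ hγ N, ?_, ?_⟩
  · have hA : 1 ≤ pinnedChainScaleA γ N := one_le_pinnedChainScaleA hγ N
    have hB : 0 ≤ pinnedChainScaleB ω₂ lam β γ N := pinnedChainScaleB_nonneg hω.le hl hβ hγ N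
    have hC : 0 ≤ pinnedChainScaleC ω₂ lam β γ N := pinnedChainScaleC_nonneg hω.le hl hβ hγ N
    have hA0 : 0 ≤ pinnedChainScaleA γ N := by linarith
    positivity
  · intro K hK x hx η T M hη hM hAMT t ht
    exact cellChain_drivenFlow_energyScale hω hl hβ hγ c N hK x hx η T M hη hM hAMT t ht

end Summit.AtomisticToContinuum.FouriersLaw.Theorems.PrefixSteadyStates.LineRegistered
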